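import Mathlib.Analysis.Calculus.IteratedDeriv.Lemmas
import Mathlib.Analysis.Calculus.ContDiff.Bounds
import Literature.Analysis.Calculus.LineRestrictionIteratedDeriv
import HarnessLib

/-!
# The polarised third-derivative functional of Harish-Chandra's limit formula on a smooth `Vandermonde • W` germ

Topic `Analysis/Calculus`; cell `pub/hodgecm-mathlib`, N8-INNER brick (10)(C′) «CORNER EP PACKAGE» (census
`CENSUS-N8-brick10Cprime-cornerEP.v1` §3 (V)).  Count-neutral Literature THEOREMS (`--kind proof --supports
stmt-HodgeConjecture-24833`); no `def`, no instance, no notation, no `sorry`; Mathlib + ★ `LineRestrictionIteratedDeriv`.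

THE LETTER'S FUNCTIONAL (★ `Rogawski1990.ArchCentralLimitFormulaRankTwo`, Rogawski 1990 §8.4 p. 126: Harish-Chandra's operator
`ω = ∏_{i<j}(∂_i − ∂_j)` written by polarisation): for a function `Φ` of three angles,
`L[Φ](x) := (1/48) Σ_{ε ∈ {±1}³} ε₁ε₂ε₃ · (d/ds)³|_{s=0} Φ (x + s·v_ε)`, `v_ε = (ε₁+ε₂, −ε₁+ε₃, −ε₂−ε₃)` (signs indexed by
`Fin 3 → Bool` exactly as in the letter).  This file evaluates `L` on the germs the corner package produces: a SMOOTH function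
`Φ = Vand • W` near a diagonal point `x₀ = (t,t,t)`, `Vand x = (x₀−x₁)(x₀−x₂)(x₁−x₂)` (★ `VandermondeDivisionThree`'s letter):
* §1 along a ray from a diagonal point `Vand (x₀ + s v) = s³ · Vand v`, so `(d/ds)³|₀ [Vand • W](x₀ + s v) = (6 · Vand v) • W x₀`
  (Leibniz, Mathlib `iteratedDerivWithin_smul` + `iteratedDeriv_fun_pow_zero`);
* §2 the signed sum: `Σ_ε ε₁ε₂ε₃ · Vand v_ε = 96`, hence **`L[Vand • W](x₀) = 12 • W x₀`** (`exists`-free, the constant is the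
  letter's own `ω(ρ′Δ)(ζ•1) = −12i` up to the unit `ρ′Δ ∕ Vand → −i`), also in the letter's literal complex-scalar form;
* §3 continuity: for a globally smooth `Φ` (parameter allowed) the functional `x ↦ L[Φ](x)` is continuous — it is a finite sum of
  `iteratedFDeriv ℝ 3 Φ (x) (v_ε, v_ε, v_ε)` (★ `iteratedDeriv_lineRestriction`) — so a limit of `L[Φ]` along any set accumulating at
  `x₀` equals `12 • W x₀` when `Φ = Vand • W` near `x₀`.
Consumer: the corner EP assembly (`h(b_ζ) ≠ 0`): with `Φ^{st} = Vand • W` smooth across the corner and `L[Φ^{st}] → 6c·f₀(ζ•1)` by the ★ letter,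
`W(x₀) = c·f₀(ζ•1)∕2 ≠ 0`.
HONEST LABEL: count-neutral Mathlib-side calculus; HC_CM is proved only modulo the printed citations (hLiu418 = `stmt-HodgeConjecture-24832`,
h413 = `stmt-HodgeConjecture-24833`) until rung 0 closes.

## References
* [Rogawski1990] J. D. Rogawski, *Automorphic Representations of Unitary Groups in Three Variables*, Ann. of Math. Stud. 123 (1990), §8.4
  pp. 126–127 (the operator `ω` and the constant at the centre).
* [HarishChandra1975HARRG1] Harish-Chandra, *Harmonic analysis on real reductive groups I*, J. Funct. Anal. 19 (1975), §17 Lemma 17.5.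
-/

noncomputable section

open Set Function Filter Topology Finset
open scoped ContDiff

namespace Literature.Analysis.Calculus

universe u

variable {P : Type u} [NormedAddCommGroup P] [NormedSpace ℝ P]
  {E : Type u} [NormedAddCommGroup E] [NormedSpace ℝ E]

/-! ## §1 One ray from a diagonal point -/

omit [NormedSpace ℝ P] in
/-- Along a ray from a diagonal point the Vandermonde product is `s³ · Vand v`. [folklore] [cite: Rogawski1990, §8.4 p. 126] -/
theorem vandermonde_diag_add_smul (t s : ℝ) (v : Fin 3 → ℝ) :
    (((fun _ : Fin 3 => t) + s • v) 0 - ((fun _ : Fin 3 => t) + s • v) 1) *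
      (((fun _ : Fin 3 => t) + s • v) 0 - ((fun _ : Fin 3 => t) + s • v) 2) *
      (((fun _ : Fin 3 => t) + s • v) 1 - ((fun _ : Fin 3 => t) + s • v) 2) =
      s ^ 3 * ((v 0 - v 1) * (v 0 - v 2) * (v 1 - v 2)) := by
  simp only [Pi.add_apply, Pi.smul_apply, smul_eq_mul]
  ring

/-- Leibniz at a cube: `(d/ds)³|₀ (s³ • g s) = 6 • g 0` for `g` thrice continuously differentiable at `0`.
[folklore] [cite: HarishChandra1975HARRG1, §17 Lemma 17.5] -/
theorem iteratedDeriv_three_pow_three_smul {g : ℝ → E} (hg : ContDiffAt ℝ 3 g 0) :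
    iteratedDeriv 3 (fun s : ℝ => s ^ 3 • g s) 0 = (6 : ℝ) • g 0 := by
  have hf : ContDiffAt ℝ 3 (fun s : ℝ => s ^ 3) 0 := (contDiff_id.pow 3).contDiffAt
  have h := iteratedDerivWithin_smul (s := Set.univ) (x := (0 : ℝ)) (n := 3) (Set.mem_univ _) uniqueDiffOn_univ
    hf.contDiffWithinAt hg.contDiffWithinAt
  simp only [iteratedDerivWithin_univ] at h
  have hfg : ((fun s : ℝ => s ^ 3) • g) = fun s => s ^ 3 • g s := rfl
  rw [hfg] at h
  rw [h]
  simp only [Finset.sum_range_succ, Finset.sum_range_zero, zero_add, iteratedDeriv_fun_pow_zero]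
  norm_num [Nat.choose, Nat.factorial]

/-- **One ray**: for `W` smooth, `(d/ds)³|₀ [Vand • W](x₀ + s v) = (6 · Vand v) • W x₀` at a diagonal point `x₀ = (t,t,t)`
(parameter `z` along). [folklore] [cite: Rogawski1990, §8.4 p. 126] [cite: HarishChandra1975HARRG1, §17 Lemma 17.5] -/
theorem iteratedDeriv_three_vandermonde_smul_diag (W : (Fin 3 → ℝ) × P → E) (hW : ContDiff ℝ ∞ W) (t : ℝ) (z : P)
    (v : Fin 3 → ℝ) :
    iteratedDeriv 3 (fun s : ℝ => ((((fun _ : Fin 3 => t) + s • v) 0 - ((fun _ : Fin 3 => t) + s • v) 1) *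
      (((fun _ : Fin 3 => t) + s • v) 0 - ((fun _ : Fin 3 => t) + s • v) 2) *
      (((fun _ : Fin 3 => t) + s • v) 1 - ((fun _ : Fin 3 => t) + s • v) 2)) • W ((fun _ : Fin 3 => t) + s • v, z)) 0 =
      (6 * ((v 0 - v 1) * (v 0 - v 2) * (v 1 - v 2))) • W (fun _ : Fin 3 => t, z) := by
  set g : ℝ → E := fun s => ((v 0 - v 1) * (v 0 - v 2) * (v 1 - v 2)) • W ((fun _ : Fin 3 => t) + s • v, z) with hg
  have hgs : ContDiff ℝ ∞ g := by
    refine contDiff_const.smul (hW.comp ?_)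
    exact ((contDiff_const.add (contDiff_id.smul contDiff_const)).prodMk contDiff_const)
  have heq : (fun s : ℝ => ((((fun _ : Fin 3 => t) + s • v) 0 - ((fun _ : Fin 3 => t) + s • v) 1) *
      (((fun _ : Fin 3 => t) + s • v) 0 - ((fun _ : Fin 3 => t) + s • v) 2) *
      (((fun _ : Fin 3 => t) + s • v) 1 - ((fun _ : Fin 3 => t) + s • v) 2)) • W ((fun _ : Fin 3 => t) + s • v, z)) =
      fun s : ℝ => s ^ 3 • g s := by
    funext s
    rw [vandermonde_diag_add_smul, hg, smul_smul]
  rw [heq, iteratedDeriv_three_pow_three_smul ((hgs.of_le (by norm_cast)).contDiffAt)]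
  simp only [hg, zero_smul, add_zero, smul_smul]

/-! ## §2 The signed sum over `ε ∈ {±1}³` -/

omit [NormedSpace ℝ P] in
/-- **The combinatorial constant**: `Σ_ε ε₁ε₂ε₃ · Vand (v_ε) = 96` for the letter's vectors
`v_ε = (ε₁+ε₂, −ε₁+ε₃, −ε₂−ε₃)`, signs indexed by `Fin 3 → Bool`. [folklore] [cite: Rogawski1990, §8.4 pp. 126–127] -/
theorem sum_sign_mul_vandermonde_letterVec :
    ∑ ε : Fin 3 → Bool, ((if ε 0 then (1 : ℝ) else -1) * (if ε 1 then (1 : ℝ) else -1) * (if ε 2 then (1 : ℝ) else -1)) *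
      (((![(if ε 0 then (1 : ℝ) else -1) + (if ε 1 then (1 : ℝ) else -1),
          -(if ε 0 then (1 : ℝ) else -1) + (if ε 2 then (1 : ℝ) else -1),
          -(if ε 1 then (1 : ℝ) else -1) - (if ε 2 then (1 : ℝ) else -1)] : Fin 3 → ℝ) 0 -
        (![(if ε 0 then (1 : ℝ) else -1) + (if ε 1 then (1 : ℝ) else -1),
          -(if ε 0 then (1 : ℝ) else -1) + (if ε 2 then (1 : ℝ) else -1),
          -(if ε 1 then (1 : ℝ) else -1) - (if ε 2 then (1 : ℝ) else -1)] : Fin 3 → ℝ) 1) *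
       ((![(if ε 0 then (1 : ℝ) else -1) + (if ε 1 then (1 : ℝ) else -1),
          -(if ε 0 then (1 : ℝ) else -1) + (if ε 2 then (1 : ℝ) else -1),
          -(if ε 1 then (1 : ℝ) else -1) - (if ε 2 then (1 : ℝ) else -1)] : Fin 3 → ℝ) 0 -
        (![(if ε 0 then (1 : ℝ) else -1) + (if ε 1 then (1 : ℝ) else -1),
          -(if ε 0 then (1 : ℝ) else -1) + (if ε 2 then (1 : ℝ) else -1),
          -(if ε 1 then (1 : ℝ) else -1) - (if ε 2 then (1 : ℝ) else -1)] : Fin 3 → ℝ) 2) *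
       ((![(if ε 0 then (1 : ℝ) else -1) + (if ε 1 then (1 : ℝ) else -1),
          -(if ε 0 then (1 : ℝ) else -1) + (if ε 2 then (1 : ℝ) else -1),
          -(if ε 1 then (1 : ℝ) else -1) - (if ε 2 then (1 : ℝ) else -1)] : Fin 3 → ℝ) 1 -
        (![(if ε 0 then (1 : ℝ) else -1) + (if ε 1 then (1 : ℝ) else -1),
          -(if ε 0 then (1 : ℝ) else -1) + (if ε 2 then (1 : ℝ) else -1),
          -(if ε 1 then (1 : ℝ) else -1) - (if ε 2 then (1 : ℝ) else -1)] : Fin 3 → ℝ) 2)) = 96 := by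
  -- enumerate the eight sign patterns
  have hU : (Finset.univ : Finset (Fin 3 → Bool)) =
      Finset.univ.image (fun b : Bool × Bool × Bool => ![b.1, b.2.1, b.2.2]) := by
    refine (Finset.eq_univ_iff_forall.2 fun ε => ?_).symm
    refine Finset.mem_image.2 ⟨(ε 0, ε 1, ε 2), Finset.mem_univ _, ?_⟩
    funext i; fin_cases i <;> rfl
  rw [hU, Finset.sum_image]
  · simp only [Fintype.sum_prod_type, Fintype.univ_bool, Finset.sum_insert (by decide : true ∉ ({false} : Finset Bool)),
      Finset.sum_singleton, Matrix.cons_val_zero, Matrix.cons_val_one, Matrix.cons_val_two, Matrix.head_cons,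
      Matrix.tail_cons, if_true, Bool.false_eq_true, if_false]
    norm_num
  · intro b _ b' _ h
    have h0 := congrFun h 0
    have h1 := congrFun h 1
    have h2 := congrFun h 2
    simp only [Matrix.cons_val_zero, Matrix.cons_val_one, Matrix.cons_val_two, Matrix.head_cons, Matrix.tail_cons] at h0 h1 h2
    exact Prod.ext h0 (Prod.ext h1 h2)

/-- **The letter functional on a `Vand • W` germ at a diagonal point**:
`(1/48) Σ_ε ε₁ε₂ε₃ · (d/ds)³|₀ [Vand • W](x₀ + s v_ε) = 12 • W x₀`. [folklore] [cite: Rogawski1990, §8.4 pp. 126–127]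
[cite: HarishChandra1975HARRG1, §17 Lemma 17.5] -/
theorem letterFunctional_vandermonde_smul_diag (W : (Fin 3 → ℝ) × P → E) (hW : ContDiff ℝ ∞ W) (t : ℝ) (z : P) :
    (1 / 48 : ℝ) • ∑ ε : Fin 3 → Bool,
      ((if ε 0 then (1 : ℝ) else -1) * (if ε 1 then (1 : ℝ) else -1) * (if ε 2 then (1 : ℝ) else -1)) •
        iteratedDeriv 3 (fun s : ℝ =>
          ((((fun _ : Fin 3 => t) + s • (![(if ε 0 then (1 : ℝ) else -1) + (if ε 1 then (1 : ℝ) else -1),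
              -(if ε 0 then (1 : ℝ) else -1) + (if ε 2 then (1 : ℝ) else -1),
              -(if ε 1 then (1 : ℝ) else -1) - (if ε 2 then (1 : ℝ) else -1)] : Fin 3 → ℝ)) 0 -
            ((fun _ : Fin 3 => t) + s • (![(if ε 0 then (1 : ℝ) else -1) + (if ε 1 then (1 : ℝ) else -1),
              -(if ε 0 then (1 : ℝ) else -1) + (if ε 2 then (1 : ℝ) else -1),
              -(if ε 1 then (1 : ℝ) else -1) - (if ε 2 then (1 : ℝ) else -1)] : Fin 3 → ℝ)) 1) *
           (((fun _ : Fin 3 => t) + s • (![(if ε 0 then (1 : ℝ) else -1) + (if ε 1 then (1 : ℝ) else -1),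
              -(if ε 0 then (1 : ℝ) else -1) + (if ε 2 then (1 : ℝ) else -1),
              -(if ε 1 then (1 : ℝ) else -1) - (if ε 2 then (1 : ℝ) else -1)] : Fin 3 → ℝ)) 0 -
            ((fun _ : Fin 3 => t) + s • (![(if ε 0 then (1 : ℝ) else -1) + (if ε 1 then (1 : ℝ) else -1),
              -(if ε 0 then (1 : ℝ) else -1) + (if ε 2 then (1 : ℝ) else -1),
              -(if ε 1 then (1 : ℝ) else -1) - (if ε 2 then (1 : ℝ) else -1)] : Fin 3 → ℝ)) 2) *
           (((fun _ : Fin 3 => t) + s • (![(if ε 0 then (1 : ℝ) else -1) + (if ε 1 then (1 : ℝ) else -1),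
              -(if ε 0 then (1 : ℝ) else -1) + (if ε 2 then (1 : ℝ) else -1),
              -(if ε 1 then (1 : ℝ) else -1) - (if ε 2 then (1 : ℝ) else -1)] : Fin 3 → ℝ)) 1 -
            ((fun _ : Fin 3 => t) + s • (![(if ε 0 then (1 : ℝ) else -1) + (if ε 1 then (1 : ℝ) else -1),
              -(if ε 0 then (1 : ℝ) else -1) + (if ε 2 then (1 : ℝ) else -1),
              -(if ε 1 then (1 : ℝ) else -1) - (if ε 2 then (1 : ℝ) else -1)] : Fin 3 → ℝ)) 2)) •
          W ((fun _ : Fin 3 => t) + s • (![(if ε 0 then (1 : ℝ) else -1) + (if ε 1 then (1 : ℝ) else -1),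
              -(if ε 0 then (1 : ℝ) else -1) + (if ε 2 then (1 : ℝ) else -1),
              -(if ε 1 then (1 : ℝ) else -1) - (if ε 2 then (1 : ℝ) else -1)] : Fin 3 → ℝ), z)) 0 =
      (12 : ℝ) • W (fun _ : Fin 3 => t, z) := by
  simp_rw [iteratedDeriv_three_vandermonde_smul_diag W hW t z, smul_smul, ← Finset.sum_smul, smul_smul]
  congr 1
  simp_rw [show ∀ a b : ℝ, a * (6 * b) = 6 * (a * b) from fun a b => by ring]
  rw [← Finset.mul_sum, sum_sign_mul_vandermonde_letterVec]
  norm_num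

/-! ## §3 Continuity of the functional for a smooth function; the limit form the assembly consumes -/

/-- One ray term of the functional is the third Fréchet derivative on the diagonal triple of directions — hence continuous in the
base point for a smooth `Φ`. [folklore] [cite: HarishChandra1975HARRG1, §17 Lemma 17.5] -/
theorem iteratedDeriv_three_ray_eq_iteratedFDeriv (Φ : (Fin 3 → ℝ) × P → E) (hΦ : ContDiff ℝ ∞ Φ) (v : Fin 3 → ℝ)
    (q : (Fin 3 → ℝ) × P) :
    iteratedDeriv 3 (fun s : ℝ => Φ (q.1 + s • v, q.2)) 0 = iteratedFDeriv ℝ 3 Φ q fun _ => ((v, 0) : (Fin 3 → ℝ) × P) := by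
  have h := iteratedDeriv_lineRestriction (n := 3) (hΦ.of_le (by norm_cast)) q ((v, 0) : (Fin 3 → ℝ) × P) 0
  rw [zero_smul, add_zero] at h
  rw [← h]
  congr 1
  funext s
  congr 1
  ext <;> simp

/-- **Continuity of the letter functional** for a smooth `Φ` (parameter allowed). [folklore] [cite: Rogawski1990, §8.4 p. 126]
[cite: HarishChandra1975HARRG1, §17 Lemma 17.5] -/
theorem continuous_letterFunctional (Φ : (Fin 3 → ℝ) × P → E) (hΦ : ContDiff ℝ ∞ Φ) :
    Continuous fun q : (Fin 3 → ℝ) × P => (1 / 48 : ℝ) • ∑ ε : Fin 3 → Bool,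
      ((if ε 0 then (1 : ℝ) else -1) * (if ε 1 then (1 : ℝ) else -1) * (if ε 2 then (1 : ℝ) else -1)) •
        iteratedDeriv 3 (fun s : ℝ => Φ (q.1 + s • (![(if ε 0 then (1 : ℝ) else -1) + (if ε 1 then (1 : ℝ) else -1),
              -(if ε 0 then (1 : ℝ) else -1) + (if ε 2 then (1 : ℝ) else -1),
              -(if ε 1 then (1 : ℝ) else -1) - (if ε 2 then (1 : ℝ) else -1)] : Fin 3 → ℝ), q.2)) 0 := by
  refine continuous_const.smul (continuous_finsetSum _ fun ε _ => continuous_const.smul ?_)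
  simp_rw [iteratedDeriv_three_ray_eq_iteratedFDeriv Φ hΦ]
  have h1 : Continuous (iteratedFDeriv ℝ 3 Φ) := hΦ.continuous_iteratedFDeriv (by norm_cast)
  exact (continuous_eval_const _).comp h1

/-- **The limit form consumed by the corner EP assembly.**  If `Φ` is smooth and agrees near `((t,t,t), z₀)` with `Vand • W`, `W` smooth,
then the letter functional of `Φ` tends to `12 • W ((t,t,t), z₀)` along ANY filter finer than the neighbourhood filter (in particular
along regular points). [folklore] [cite: Rogawski1990, §8.4 pp. 126–127] [cite: HarishChandra1975HARRG1, §17 Lemma 17.5] -/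
theorem tendsto_letterFunctional_of_eventuallyEq_vandermonde_smul (Φ : (Fin 3 → ℝ) × P → E) (hΦ : ContDiff ℝ ∞ Φ)
    (W : (Fin 3 → ℝ) × P → E) (hW : ContDiff ℝ ∞ W) (t : ℝ) (z₀ : P)
    (heq : ∀ᶠ q in 𝓝 ((fun _ : Fin 3 => t, z₀) : (Fin 3 → ℝ) × P),
      Φ q = ((q.1 0 - q.1 1) * (q.1 0 - q.1 2) * (q.1 1 - q.1 2)) • W q)
    {l : Filter ((Fin 3 → ℝ) × P)} (hl : l ≤ 𝓝 ((fun _ : Fin 3 => t, z₀) : (Fin 3 → ℝ) × P)) :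
    Tendsto (fun q : (Fin 3 → ℝ) × P => (1 / 48 : ℝ) • ∑ ε : Fin 3 → Bool,
      ((if ε 0 then (1 : ℝ) else -1) * (if ε 1 then (1 : ℝ) else -1) * (if ε 2 then (1 : ℝ) else -1)) •
        iteratedDeriv 3 (fun s : ℝ => Φ (q.1 + s • (![(if ε 0 then (1 : ℝ) else -1) + (if ε 1 then (1 : ℝ) else -1),
              -(if ε 0 then (1 : ℝ) else -1) + (if ε 2 then (1 : ℝ) else -1),
              -(if ε 1 then (1 : ℝ) else -1) - (if ε 2 then (1 : ℝ) else -1)] : Fin 3 → ℝ), q.2)) 0)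
      l (𝓝 ((12 : ℝ) • W (fun _ : Fin 3 => t, z₀))) := by
  have hcont := (continuous_letterFunctional Φ hΦ).tendsto ((fun _ : Fin 3 => t, z₀) : (Fin 3 → ℝ) × P)
  refine (hcont.mono_left hl).congr' ?_ |>.trans ?_
  · exact Eventually.of_forall fun _ => rfl
  · -- the value at the base point is the value for `Vand • W` (germ argument), which is `12 • W`
    rw [← letterFunctional_vandermonde_smul_diag W hW t z₀]
    apply le_of_eq
    congr 2
    refine Finset.sum_congr rfl fun ε _ => ?_
    congr 1
    apply Filter.EventuallyEq.iteratedDeriv_eq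
    -- the ray `s ↦ (x₀ + s v_ε, z₀)` is continuous and passes through the base point at `s = 0`
    have hray : Tendsto (fun s : ℝ => (((fun _ : Fin 3 => t) + s • (![(if ε 0 then (1 : ℝ) else -1) + (if ε 1 then (1 : ℝ) else -1),
              -(if ε 0 then (1 : ℝ) else -1) + (if ε 2 then (1 : ℝ) else -1),
              -(if ε 1 then (1 : ℝ) else -1) - (if ε 2 then (1 : ℝ) else -1)] : Fin 3 → ℝ), z₀) : (Fin 3 → ℝ) × P))
        (𝓝 0) (𝓝 ((fun _ : Fin 3 => t, z₀) : (Fin 3 → ℝ) × P)) := by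
      have hc : Continuous fun s : ℝ => (((fun _ : Fin 3 => t) + s • (![(if ε 0 then (1 : ℝ) else -1) + (if ε 1 then (1 : ℝ) else -1),
              -(if ε 0 then (1 : ℝ) else -1) + (if ε 2 then (1 : ℝ) else -1),
              -(if ε 1 then (1 : ℝ) else -1) - (if ε 2 then (1 : ℝ) else -1)] : Fin 3 → ℝ), z₀) : (Fin 3 → ℝ) × P) := by
        fun_prop
      simpa using hc.tendsto 0
    filter_upwards [hray.eventually heq] with s hs
    simpa using hs

end Literature.Analysis.Calculus

end
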